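import Summits.HubbardSuperconductivity.HubbardSuperconductivity.Theorems.BalabanIRBirBdGPhaseCoercivityDefectBound
import Summits.HubbardSuperconductivity.HubbardSuperconductivity.Theorems.BalabanIRBirBdGPhaseCoercivityImSquareSum
import HarnessLib

/-!
# Route BalabanIR — crux 3 `BirBdGPhaseCoercivity` (item `stmt-HubbardSuperconductivity-2081`):
# the pair symbol inequality for ALL parameters

Line `bcs-dual-persistence` (reshaped, `V := K`). With the `d+id` gap function
`Δ_k = 2Δ₁(cos p₀ - cos p₁) - 4iΔ₂ sin p₀ sin p₁`, the quasiparticle energy `E_k = √(ξ_k² + |Δ_k|²) > 0`,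
`Δ_max = 4(|Δ₁|+|Δ₂|) ≥ |Δ_k|` (`norm_gap_le`), `E_max = 4 + |μ| + Δ_max ≥ E_k` (`qpEnergy_le`), the pair symbol
`𝒢(q) = Σ_k [|Δ_k|²/E_k - |Δ_k+Δ_{k+q}|²/(2(E_k+E_{k+q}))]` satisfies, for `L ≥ 5` and every texture momentum `q`,
  `(Δ₁²Δ₂²/(Δ_max² E_max)) · L² · ε(q) ≤ 𝒢(q)`,  `ε(q) = 4 - 2cos q₀ - 2cos q₁`
(`pairSymbolIneq`): the exact-defect minorant `stub_defectBound` (S6) and the parameter-free trigonometric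
sum `stub_imSquareSum` (S7). This is the input of the reduction `coercive_of_pairSymbolIneq` of the closing file
`…Theorems/BalabanIRBirBdGPhaseCoercivity.lean`. No definition is introduced.
-/

noncomputable section

set_option linter.dupNamespace false

namespace Summit.HubbardSuperconductivity.HubbardSuperconductivity.Theorems.BirBdGPhaseCoercivity

open Finset Literature.Probability.LatticeModels
open scoped ComplexConjugate

/-- `|Δ_k| ≤ 4(|Δ₁| + |Δ₂|)` for the `d+id` gap function. [folklore] -/
theorem norm_gap_le (Δ₁ Δ₂ p₀ p₁ : ℝ) :
    ‖((2 * Δ₁ * (Real.cos p₀ - Real.cos p₁) : ℝ) : ℂ) -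
        4 * Complex.I * ((Δ₂ * Real.sin p₀ * Real.sin p₁ : ℝ) : ℂ)‖ ≤ 4 * (|Δ₁| + |Δ₂|) := by
  have hc0 := Real.abs_cos_le_one p₀
  have hc1 := Real.abs_cos_le_one p₁
  have hs0 := Real.abs_sin_le_one p₀
  have hs1 := Real.abs_sin_le_one p₁
  have hA : ‖((2 * Δ₁ * (Real.cos p₀ - Real.cos p₁) : ℝ) : ℂ)‖ ≤ 4 * |Δ₁| := by
    rw [Complex.norm_real, Real.norm_eq_abs, abs_mul, abs_mul, abs_two]
    have : |Real.cos p₀ - Real.cos p₁| ≤ 2 := le_trans (abs_sub _ _) (by linarith)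
    nlinarith [abs_nonneg Δ₁, abs_nonneg (Real.cos p₀ - Real.cos p₁)]
  have hB : ‖4 * Complex.I * ((Δ₂ * Real.sin p₀ * Real.sin p₁ : ℝ) : ℂ)‖ ≤ 4 * |Δ₂| := by
    rw [norm_mul, norm_mul, Complex.norm_I, mul_one, Complex.norm_real, Real.norm_eq_abs, abs_mul,
      abs_mul]
    have h4 : ‖(4 : ℂ)‖ = 4 := by simp
    rw [h4]
    have : |Real.sin p₀| * |Real.sin p₁| ≤ 1 := by
      nlinarith [abs_nonneg (Real.sin p₀), abs_nonneg (Real.sin p₁)]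
    nlinarith [abs_nonneg Δ₂, abs_nonneg (Real.sin p₀), abs_nonneg (Real.sin p₁)]
  calc ‖((2 * Δ₁ * (Real.cos p₀ - Real.cos p₁) : ℝ) : ℂ) -
        4 * Complex.I * ((Δ₂ * Real.sin p₀ * Real.sin p₁ : ℝ) : ℂ)‖
      ≤ ‖((2 * Δ₁ * (Real.cos p₀ - Real.cos p₁) : ℝ) : ℂ)‖ +
        ‖4 * Complex.I * ((Δ₂ * Real.sin p₀ * Real.sin p₁ : ℝ) : ℂ)‖ := norm_sub_le _ _
    _ ≤ 4 * |Δ₁| + 4 * |Δ₂| := add_le_add hA hB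
    _ = 4 * (|Δ₁| + |Δ₂|) := by ring

/-- `E_k = √(ξ_k² + |Δ_k|²) ≤ 4 + |μ| + 4(|Δ₁|+|Δ₂|)`. [folklore] -/
theorem qpEnergy_le (μ Δ₁ Δ₂ p₀ p₁ : ℝ) :
    Real.sqrt ((-2 * Real.cos p₀ - 2 * Real.cos p₁ - μ) ^ 2 +
        ‖((2 * Δ₁ * (Real.cos p₀ - Real.cos p₁) : ℝ) : ℂ) -
          4 * Complex.I * ((Δ₂ * Real.sin p₀ * Real.sin p₁ : ℝ) : ℂ)‖ ^ 2) ≤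
      4 + |μ| + 4 * (|Δ₁| + |Δ₂|) := by
  set a : ℝ := -2 * Real.cos p₀ - 2 * Real.cos p₁ - μ with ha
  set b : ℝ := ‖((2 * Δ₁ * (Real.cos p₀ - Real.cos p₁) : ℝ) : ℂ) -
    4 * Complex.I * ((Δ₂ * Real.sin p₀ * Real.sin p₁ : ℝ) : ℂ)‖ with hb
  have hb0 : 0 ≤ b := norm_nonneg _
  have hbA : b ≤ 4 * (|Δ₁| + |Δ₂|) := norm_gap_le Δ₁ Δ₂ p₀ p₁
  have haA : |a| ≤ 4 + |μ| := by
    have hc0 := Real.abs_cos_le_one p₀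
    have hc1 := Real.abs_cos_le_one p₁
    rw [ha]
    calc |-2 * Real.cos p₀ - 2 * Real.cos p₁ - μ|
        ≤ |-2 * Real.cos p₀ - 2 * Real.cos p₁| + |μ| := abs_sub _ _
      _ ≤ (|-2 * Real.cos p₀| + |2 * Real.cos p₁|) + |μ| := by
          gcongr; exact abs_sub _ _
      _ ≤ 4 + |μ| := by
          rw [abs_mul, abs_mul]
          norm_num
          linarith
  have hsq : a ^ 2 + b ^ 2 ≤ (|a| + b) ^ 2 := by
    nlinarith [abs_nonneg a, sq_abs a]
  calc Real.sqrt (a ^ 2 + b ^ 2) ≤ Real.sqrt ((|a| + b) ^ 2) := Real.sqrt_le_sqrt hsq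
    _ = |a| + b := Real.sqrt_sq (by positivity)
    _ ≤ 4 + |μ| + 4 * (|Δ₁| + |Δ₂|) := by linarith

/-- **The pair symbol inequality for ALL parameters** (S6 + S7): with `Δ_max = 4(|Δ₁|+|Δ₂|)`,
`E_max = 4 + |μ| + Δ_max`, for `L ≥ 5` and every texture momentum `q`,
`(Δ₁²Δ₂²/(Δ_max² E_max)) · L² · ε(q) ≤ 𝒢(q)`. [folklore] -/
theorem pairSymbolIneq {L : ℕ} [NeZero L] (μ Δ₁ Δ₂ : ℝ) (hL : 5 ≤ L) (h₁ : Δ₁ ≠ 0) (h₂ : Δ₂ ≠ 0)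
    (E : TorusSite 2 L → ℝ) (Δ : TorusSite 2 L → ℂ)
    (hΔ : ∀ k, Δ k = ((2 * Δ₁ * (Real.cos (latticeMomentum L k 0) - Real.cos (latticeMomentum L k 1)) : ℝ) : ℂ) -
        4 * Complex.I * ((Δ₂ * Real.sin (latticeMomentum L k 0) * Real.sin (latticeMomentum L k 1) : ℝ) : ℂ))
    (hE : ∀ k, E k = Real.sqrt ((-2 * Real.cos (latticeMomentum L k 0) - 2 * Real.cos (latticeMomentum L k 1) - μ) ^ 2 +
        ‖Δ k‖ ^ 2))
    (hEpos : ∀ k, 0 < E k) (q : TorusSite 2 L) :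
    Δ₁ ^ 2 * Δ₂ ^ 2 / ((4 * (|Δ₁| + |Δ₂|)) ^ 2 * (4 + |μ| + 4 * (|Δ₁| + |Δ₂|))) * ((L ^ 2 : ℕ) : ℝ) *
        (4 - 2 * Real.cos (latticeMomentum L q 0) - 2 * Real.cos (latticeMomentum L q 1)) ≤
      ∑ k, (‖Δ k‖ ^ 2 / E k - ‖Δ k + Δ (k + q)‖ ^ 2 / (2 * (E k + E (k + q)))) := by
  set Dm : ℝ := 4 * (|Δ₁| + |Δ₂|) with hDm
  set Em : ℝ := 4 + |μ| + 4 * (|Δ₁| + |Δ₂|) with hEm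
  have hDm0 : 0 < Dm := by
    have : 0 < |Δ₁| := abs_pos.2 h₁
    have : 0 < |Δ₂| := abs_pos.2 h₂
    rw [hDm]; linarith
  have hΔle : ∀ k, ‖Δ k‖ ≤ Dm := fun k => by rw [hΔ k]; exact norm_gap_le Δ₁ Δ₂ _ _
  have hEle : ∀ k, E k ≤ Em := fun k => by rw [hE k, hΔ k]; exact qpEnergy_le μ Δ₁ Δ₂ _ _
  have hEm0 : 0 < Em := lt_of_lt_of_le (hEpos 0) (hEle 0)
  have h6 := stub_defectBound Δ E Dm Em hEpos hEle hDm0 hΔle q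
  have h7 := stub_imSquareSum hL Δ₁ Δ₂ Δ hΔ q
  refine le_trans ?_ h6
  have hc : Δ₁ ^ 2 * Δ₂ ^ 2 / (Dm ^ 2 * Em) * ((L ^ 2 : ℕ) : ℝ) *
      (4 - 2 * Real.cos (latticeMomentum L q 0) - 2 * Real.cos (latticeMomentum L q 1)) =
      (4 * Dm ^ 2 * Em)⁻¹ * (4 * Δ₁ ^ 2 * Δ₂ ^ 2 * ((L ^ 2 : ℕ) : ℝ) *
        (4 - 2 * Real.cos (latticeMomentum L q 0) - 2 * Real.cos (latticeMomentum L q 1))) := by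
    field_simp
  rw [hc]
  exact mul_le_mul_of_nonneg_left h7 (by positivity)

end Summit.HubbardSuperconductivity.HubbardSuperconductivity.Theorems.BirBdGPhaseCoercivity

end
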